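import Summits.CriticalPhenomena.Ising3DConformalLimit.Theses.SynchronousCoupling
import Literature.Probability.LatticeModels.GibbsSpecification
import HarnessLib

/-!
# Line `Sketch` for the crux `SynchronousCoupling.DilationJoinings` (stmt-CriticalPhenomena-18762) — stub `stub_covariantReduction`

Covariant reduction of the window: if the pair law `π` on `SpinConfig ℤ³ × SpinConfig ℤ³` is
invariant under the skew shifts `(σ¹, σ²) ↦ (θ_{p•a} σ¹, θ_a σ²)` for every `a ∈ ℤ³`
(`θ_v σ (x) = σ (x - v)`, tree `configShift`), then the mixed second moment of
(`α ×` the `p b`-block of copy 1 at corner `p b u`) minus (`β ×` the `b`-block of copy 2 at corner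
`b u`) does not depend on the window position `u`.

Proof: a pure change of variables. With `a := b • u` the skew shift `Θ_a` is measurable and
`π`-preserving, so `∫ G ∂π = ∫ G ∂(π.map Θ_a) = ∫ G ∘ Θ_a ∂π` (`MeasureTheory.integral_map`, no
integrability needed); pointwise `σ_x (θ_v σ) = σ_{x - v}` and the box `∏ Ico (v i) (v i + L)`
re-indexes to `∏ Ico 0 L` under `x ↦ x - v`.

Helper file of the line `Sketch` (lead skeleton `Cruxes/DilationJoinings/Lines/Sketch.lean`): proves
the registered stub `stub_covariantReduction` verbatim (name + signature). No definitions, no named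
facts, no sorry.
-/

noncomputable section

namespace Summit.CriticalPhenomena.Ising3DConformalLimit.Cruxes.DilationJoinings.Sketch

open MeasureTheory Literature.Probability.LatticeModels

/-- Shifting the configuration by `v` moves the spin read at `x` to the spin at `x - v`:
`σ_x (θ_v σ) = σ_{x - v}`. -/
private theorem spinAt_configShift (v x : Site 3) (σ : SpinConfig (Site 3)) :
    spinAt x (configShift v σ) = spinAt (x - v) σ := by
  simp [spinAt, configShift_apply]

/-- Re-indexing a box sum: summing `f (x - v)` over the box with corner `v` and side `L` is summing
`f` over the box with corner `0` and side `L`. -/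
private theorem sum_box_sub (L : ℤ) (v : Site 3) (f : Site 3 → ℝ) :
    ∑ x ∈ Fintype.piFinset (fun i : Fin 3 => Finset.Ico (v i) (v i + L)), f (x - v)
      = ∑ y ∈ Fintype.piFinset (fun _ : Fin 3 => Finset.Ico (0:ℤ) L), f y := by
  refine Finset.sum_nbij' (fun x => x - v) (fun y => y + v) ?_ ?_ ?_ ?_ ?_
  · intro x hx
    simp only [Fintype.mem_piFinset, Finset.mem_Ico] at hx ⊢
    intro i
    have h := hx i
    simp only [Pi.sub_apply]
    constructor <;> linarith [h.1, h.2]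
  · intro y hy
    simp only [Fintype.mem_piFinset, Finset.mem_Ico] at hy ⊢
    intro i
    have h := hy i
    simp only [Pi.add_apply]
    constructor <;> linarith [h.1, h.2]
  · intro x _
    simp
  · intro y _
    simp
  · intro x _
    rfl

/-- Shifting the configuration by `v` and the box corner by `v` cancel:
`∑_{x ∈ v + [0,L)³} σ_x (θ_v σ) = ∑_{x ∈ [0,L)³} σ_x (σ)`. -/
private theorem sum_box_spinAt_configShift (L : ℤ) (v : Site 3) (σ : SpinConfig (Site 3)) :
    ∑ x ∈ Fintype.piFinset (fun i : Fin 3 => Finset.Ico (v i) (v i + L)), spinAt x (configShift v σ)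
      = ∑ x ∈ Fintype.piFinset (fun _ : Fin 3 => Finset.Ico (0:ℤ) L), spinAt x σ := by
  simp only [spinAt_configShift]
  exact sum_box_sub L v (fun x => spinAt x σ)

/-- Change of variables under a skew-shift-invariant pair law: for measurable `F`,
`∫ F ∘ Θ_a ∂π = ∫ F ∂π` where `Θ_a (σ¹, σ²) = (θ_{p•a} σ¹, θ_a σ²)` and `π.map Θ_a = π`. -/
private theorem integral_comp_skewShift (p : ℕ)
    (π : Measure (SpinConfig (Site 3) × SpinConfig (Site 3))) (a : Site 3)
    (hπ : π.map (fun q => (configShift (fun i => (p:ℤ) * a i) q.1, configShift a q.2)) = π)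
    (F : SpinConfig (Site 3) × SpinConfig (Site 3) → ℝ) (hF : Measurable F) :
    ∫ q, F (configShift (fun i => (p:ℤ) * a i) q.1, configShift a q.2) ∂π = ∫ q, F q ∂π := by
  have hΘ : Measurable (fun q : SpinConfig (Site 3) × SpinConfig (Site 3) =>
      (configShift (S := ℤˣ) (fun i => (p:ℤ) * a i) q.1, configShift (S := ℤˣ) a q.2)) :=
    ((configShift _).measurable.comp measurable_fst).prodMk
      ((configShift _).measurable.comp measurable_snd)
  calc ∫ q, F (configShift (fun i => (p:ℤ) * a i) q.1, configShift a q.2) ∂π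
      = ∫ q, F q ∂(π.map (fun q => (configShift (fun i => (p:ℤ) * a i) q.1, configShift a q.2))) :=
        (integral_map hΘ.aemeasurable hF.aestronglyMeasurable).symm
    _ = ∫ q, F q ∂π := by rw [hπ]

/-- **Stub `stub_covariantReduction`** of the line `Sketch` (crux stmt-CriticalPhenomena-18762):
covariant reduction of the window. If the pair law `π` is invariant under the skew shifts
`(σ¹, σ²) ↦ (θ_{p•a} σ¹, θ_a σ²)` for all `a ∈ ℤ³` (`θ_v σ (x) = σ (x - v)`, tree `configShift`),
then the mixed second moment of (`α ×` the `p b`-block of copy 1 at corner `p b u`, `β ×` the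
`b`-block of copy 2 at corner `b u`) equals the one at `u = 0` (change of variables `a = b • u`). -/
theorem stub_covariantReduction :
    ∀ (p b : ℕ) (π : Measure (SpinConfig (Site 3) × SpinConfig (Site 3))),
      (∀ a : Site 3, π.map (fun q => (configShift (fun i => (p:ℤ) * a i) q.1, configShift a q.2)) = π) →
      ∀ (α β : ℝ) (u : Fin 3 → ℤ),
        ∫ q, (α * (∑ x ∈ Fintype.piFinset (fun i : Fin 3 => Finset.Ico ((p:ℤ) * b * u i) ((p:ℤ) * b * u i + (p:ℤ) * b)), spinAt x q.1)
            - β * (∑ x ∈ Fintype.piFinset (fun i : Fin 3 => Finset.Ico ((b:ℤ) * u i) ((b:ℤ) * u i + (b:ℤ))), spinAt x q.2)) ^ 2 ∂π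
        = ∫ q, (α * (∑ x ∈ Fintype.piFinset (fun _ : Fin 3 => Finset.Ico (0:ℤ) ((p:ℤ) * b)), spinAt x q.1)
            - β * (∑ x ∈ Fintype.piFinset (fun _ : Fin 3 => Finset.Ico (0:ℤ) ((b:ℤ))), spinAt x q.2)) ^ 2 ∂π := by
  intro p b π hπ α β u
  -- the integrand at window position `u` is measurable
  have hG : Measurable fun q : SpinConfig (Site 3) × SpinConfig (Site 3) =>
      (α * (∑ x ∈ Fintype.piFinset (fun i : Fin 3 =>
          Finset.Ico ((p:ℤ) * b * u i) ((p:ℤ) * b * u i + (p:ℤ) * b)), spinAt x q.1)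
        - β * (∑ x ∈ Fintype.piFinset (fun i : Fin 3 =>
          Finset.Ico ((b:ℤ) * u i) ((b:ℤ) * u i + (b:ℤ))), spinAt x q.2)) ^ 2 := by
    fun_prop
  -- copy 1: the `p b`-box at corner `p b u`, read through `θ_{p•(b•u)}`, is the box at the origin
  have h1 : ∀ σ : SpinConfig (Site 3),
      ∑ x ∈ Fintype.piFinset (fun i : Fin 3 =>
          Finset.Ico ((p:ℤ) * b * u i) ((p:ℤ) * b * u i + (p:ℤ) * b)),
        spinAt x (configShift (fun i => (p:ℤ) * ((b:ℤ) * u i)) σ)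
      = ∑ x ∈ Fintype.piFinset (fun _ : Fin 3 => Finset.Ico (0:ℤ) ((p:ℤ) * b)), spinAt x σ := by
    intro σ
    have hv : (fun i => (p:ℤ) * ((b:ℤ) * u i)) = fun i => (p:ℤ) * b * u i :=
      funext fun i => by ring
    rw [hv]
    exact sum_box_spinAt_configShift ((p:ℤ) * b) (fun i => (p:ℤ) * b * u i) σ
  -- copy 2: the `b`-box at corner `b u`, read through `θ_{b•u}`, is the box at the origin
  have h2 : ∀ σ : SpinConfig (Site 3),
      ∑ x ∈ Fintype.piFinset (fun i : Fin 3 => Finset.Ico ((b:ℤ) * u i) ((b:ℤ) * u i + (b:ℤ))),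
        spinAt x (configShift (fun i => (b:ℤ) * u i) σ)
      = ∑ x ∈ Fintype.piFinset (fun _ : Fin 3 => Finset.Ico (0:ℤ) (b:ℤ)), spinAt x σ :=
    fun σ => sum_box_spinAt_configShift (b:ℤ) (fun i => (b:ℤ) * u i) σ
  -- change of variables `a = b • u`, then the pointwise identities
  rw [← integral_comp_skewShift p π (fun i => (b:ℤ) * u i) (hπ _) _ hG]
  refine integral_congr_ae (Filter.Eventually.of_forall fun q => ?_)
  dsimp only
  rw [h1 q.1, h2 q.2]

end Summit.CriticalPhenomena.Ising3DConformalLimit.Cruxes.DilationJoinings.Sketch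

end
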